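import Summits.NavierStokesRegularity.NavierStokesRegularity.Theorems.EfficiencyFloorProductionEfficiencyDecayReduction
import Summits.NavierStokesRegularity.NavierStokesRegularity.Theorems.EfficiencyFloorBlowupEnstrophyUnbounded
import HarnessLib

/-!
# Crux `EfficiencyFloor.ProductionEfficiencyDecay` (stmt-NavierStokesRegularity-22866) — the SUBCUBIC RUNG:
# any eventual sub-cubic enstrophy growth law `Ż ≤ A·Z^α`, `α < 3`, implies the crux-proper stub S2

`--supports stmt-NavierStokesRegularity-22866 --as helper` (line `efficiency_floor`; seat ns-ef-p3).

The route thesis: "any effective exponent below 3, indeed mere decay of the efficiency, pushes the blow-up rate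
strictly above Leray's" (Gibbon's regime `ξ < 3`, arXiv:1402.1080 Prop. 2; the planner's unfiled mined form
`Ż ≤ A Z^{9/4}`). This file kernel-checks the first half of that sentence as a RUNG of the crux, on the
registered skeleton's own data (the budget triple `(Z, Pal, S)` of `stub_enstrophyBudget`, stmt-22995, landed):

* `subcubic_le_eps_cube` (real numbers): `A z^α ≤ ε z³` once `z ≥ (A/ε)^{1/(3−α)}`, for `A, ε > 0`, `α < 3`.
* `depletion_of_subcubicLaw` (one solution): along a maximal smooth Leray–Hopf rapidly-decaying-datum solution with
  budget `dZ/dt = 2S − 2ν·Pal`, an eventual law `2S − 2ν·Pal ≤ A·Z^α` with `α < 3` gives, for every `ε > 0`, a late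
  window on which `Z > 0` and `2S − 2ν·Pal ≤ ε·Z³` — the conclusion of the crux-proper stub `stub_depletionGivenBudget`
  for that solution. The one dynamical input is the divergence of the enstrophy at blow-up
  (`BlowupEnstrophyUnbounded.main`, stmt-22867, landed: eventually `Z ≥ N` for every `N`).
* `stub_depletionGivenBudget_of_subcubicLaw`, `productionEfficiencyDecay_of_subcubicLaw` (by name): if EVERY such
  solution obeys some eventual sub-cubic law (exponent and constant may depend on the solution), then S2 (signature
  verbatim) and hence the crux `ProductionEfficiencyDecay` hold (through the landed reduction
  `productionEfficiencyDecay_of_depletion`, p585755).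

So every Gibbon-type regime `Ż ≲ Z^ξ`, `ξ < 3`, sustained up to `T` is a rung of stmt-22866 by name; the crux itself is
the borderline `ξ = 3` with vanishing constant. HONEST FRAMING: bookkeeping about HYPOTHETICAL blow-up solutions; the
sub-cubic law is a hypothesis nobody has proved; nothing about NS regularity is asserted and stmt-22866 stays open.
[folklore]
-/

-- the problem directory repeats the summit name (`NavierStokesRegularity/NavierStokesRegularity`)
set_option linter.dupNamespace false

noncomputable section

open Set Filter MeasureTheory Topology
open scoped InnerProductSpace ENNReal NNReal
open Literature.Analysis.FluidPDE

namespace Summit.NavierStokesRegularity.NavierStokesRegularity.Theorems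

namespace ProductionEfficiencyDecay

/-- **Real-number core**: for `A, ε > 0` and `α < 3`, `A z^α ≤ ε z³` as soon as `z ≥ (A/ε)^{1/(3−α)}`.
[folklore] -/
theorem subcubic_le_eps_cube {A α ε z : ℝ} (hA : 0 < A) (hα : α < 3) (hε : 0 < ε)
    (hz : (A / ε) ^ (3 - α)⁻¹ ≤ z) : A * z ^ α ≤ ε * z ^ 3 := by
  have hN0 : 0 < (A / ε) ^ (3 - α)⁻¹ := Real.rpow_pos_of_pos (div_pos hA hε) _
  have hz0 : 0 < z := hN0.trans_le hz
  have h3α : 0 < 3 - α := sub_pos.2 hα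
  -- `z^{3-α} ≥ A/ε`
  have hpow : A / ε ≤ z ^ (3 - α) := by
    calc A / ε = ((A / ε) ^ (3 - α)⁻¹) ^ (3 - α) :=
          (Real.rpow_inv_rpow (div_pos hA hε).le h3α.ne').symm
      _ ≤ z ^ (3 - α) := Real.rpow_le_rpow hN0.le hz h3α.le
  have hsplit : z ^ (3 : ℕ) = z ^ (3 - α) * z ^ α := by
    rw [← Real.rpow_natCast z 3, ← Real.rpow_add hz0]
    norm_num
  have hzα : 0 ≤ z ^ α := Real.rpow_nonneg hz0.le α
  have h1 : A ≤ ε * z ^ (3 - α) := by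
    have := mul_le_mul_of_nonneg_left hpow hε.le
    rwa [mul_div_cancel₀ _ hε.ne'] at this
  calc A * z ^ α ≤ ε * z ^ (3 - α) * z ^ α := mul_le_mul_of_nonneg_right h1 hzα
    _ = ε * z ^ 3 := by rw [hsplit]; ring

/-- **The subcubic rung, one solution.** Along a maximal smooth Leray–Hopf rapidly-decaying-datum solution on
`[0,T)` with enstrophy `Z` (`∫⁻|curl u(t)|² = ofReal Z(t)`, `Z ≥ 0` on `(0,T)`), an eventual growth law
`D(t) ≤ A·Z(t)^α` with `α < 3` for the budget's right-hand side `D = 2S − 2ν·Pal` forces, for every `ε > 0`, a late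
window `[t₁, T)` on which `Z > 0` and `D ≤ ε·Z³`: the enstrophy diverges at blow-up (`BlowupEnstrophyUnbounded.main`,
stmt-22867), and `A Z^α ≤ ε Z³` once `Z ≥ (A/ε)^{1/(3−α)}`. [folklore] -/
theorem depletion_of_subcubicLaw {ν T : ℝ} (hν : 0 < ν) (hT : 0 < T)
    {u : ℝ → EuclideanSpace ℝ (Fin 3) → EuclideanSpace ℝ (Fin 3)} {p : ℝ → EuclideanSpace ℝ (Fin 3) → ℝ}
    (hmax : IsMaximalSmoothSolution ν 0 u p T) (hLH : IsLerayHopfOn T ν 0 (u 0) u)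
    (hdec : HasRapidSpatialDecay (u 0)) {Zr D : ℝ → ℝ}
    (hZ : ∀ t ∈ Ioo 0 T, ∫⁻ x, ‖curl (u t) x‖ₑ ^ 2 = ENNReal.ofReal (Zr t) ∧ 0 ≤ Zr t)
    {α A t₀ : ℝ} (hα : α < 3) (ht₀ : t₀ ∈ Ioo 0 T) (hlaw : ∀ t ∈ Ico t₀ T, D t ≤ A * Zr t ^ α)
    {ε : ℝ} (hε : 0 < ε) :
    ∃ t₁ ∈ Ioo 0 T, ∀ t ∈ Ico t₁ T, 0 < Zr t ∧ D t ≤ ε * Zr t ^ 3 := by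
  -- a positive constant dominating `A`
  set A' : ℝ := max A 1 with hA'
  have hA'0 : 0 < A' := lt_max_of_lt_right one_pos
  -- the threshold beyond which `A' Z^α ≤ ε Z³`, and `Z ≥ 1`
  set N : ℝ := max ((A' / ε) ^ (3 - α)⁻¹) 1 with hN
  -- eventually `Z ≥ N` (blow-up forces the enstrophy to diverge)
  have hev : ∀ᶠ t in 𝓝[<] T, ENNReal.ofReal N ≤ ∫⁻ x, ‖curl (u t) x‖ₑ ^ 2 :=
    BlowupEnstrophyUnbounded.main hν hT hmax hLH hdec N
  obtain ⟨l, hlT, hl⟩ := (mem_nhdsLT_iff_exists_Ioo_subset' ht₀.2).1 hev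
  -- the window start: inside `(0,T)`, past `t₀` and past `l`
  set t₁ : ℝ := max t₀ ((max l 0 + T) / 2) with ht₁
  have hl0T : max l 0 < T := max_lt hlT hT
  have ht₁T : t₁ < T := max_lt ht₀.2 (by linarith)
  have ht₁0 : 0 < t₁ := lt_max_of_lt_left ht₀.1
  have ht₁l : l < t₁ := by
    have : l ≤ max l 0 := le_max_left _ _
    have : (max l 0 + T) / 2 ≤ t₁ := le_max_right _ _
    linarith
  refine ⟨t₁, ⟨ht₁0, ht₁T⟩, fun t ht => ?_⟩
  have htI : t ∈ Ioo 0 T := ⟨ht₁0.trans_le ht.1, ht.2⟩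
  have ht0I : t ∈ Ico t₀ T := ⟨(le_max_left _ _).trans ht.1, ht.2⟩
  obtain ⟨hZeq, hZ0⟩ := hZ t htI
  -- `N ≤ Z(t)`
  have hNt : N ≤ Zr t := by
    have h := hl ⟨ht₁l.trans_le ht.1, ht.2⟩
    rw [mem_setOf_eq, hZeq] at h
    exact (ENNReal.ofReal_le_ofReal_iff hZ0).1 h
  have hZ1 : 1 ≤ Zr t := (le_max_right _ _).trans hNt
  have hZpos : 0 < Zr t := one_pos.trans_le hZ1
  refine ⟨hZpos, ?_⟩
  have hzα : 0 ≤ Zr t ^ α := Real.rpow_nonneg hZ0 α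
  calc D t ≤ A * Zr t ^ α := hlaw t ht0I
    _ ≤ A' * Zr t ^ α := mul_le_mul_of_nonneg_right (le_max_left _ _) hzα
    _ ≤ ε * Zr t ^ 3 := subcubic_le_eps_cube hA'0 hα hε ((le_max_left _ _).trans hNt)

/-- **The subcubic rung by name: S2 ⇐ a sub-cubic law along every blow-up.** If every maximal smooth Leray–Hopf
rapidly-decaying-datum solution obeys, for its budget triple `(Z, Pal, S)` (the data of the landed
`stub_enstrophyBudget`, stmt-22995), an eventual growth law `2S − 2ν·Pal ≤ A·Z^α` with SOME `α < 3` and `A`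
(depending on the solution), then the registered crux-proper stub `stub_depletionGivenBudget` (signature verbatim)
holds. [folklore] -/
theorem stub_depletionGivenBudget_of_subcubicLaw
    (hsub : ∀ (c ν T : ℝ), 0 < c → 0 < ν → 0 < T → ∀ (u : ℝ → EuclideanSpace ℝ (Fin 3) → EuclideanSpace ℝ (Fin 3)) (p : ℝ → EuclideanSpace ℝ (Fin 3) → ℝ), Literature.Analysis.FluidPDE.IsMaximalSmoothSolution ν 0 u p T → Literature.Analysis.FluidPDE.IsLerayHopfOn T ν 0 (u 0) u → Literature.Analysis.FluidPDE.HasRapidSpatialDecay (u 0) → ∀ (Zr Pr Sr : ℝ → ℝ), (∀ t ∈ Set.Ioo 0 T, ∫⁻ x, ‖Literature.Analysis.FluidPDE.curl (u t) x‖ₑ ^ 2 = ENNReal.ofReal (Zr t) ∧ 0 ≤ Zr t ∧ 0 ≤ Pr t ∧ Pr t = ∫ x, Literature.Analysis.FluidPDE.frobeniusNormSq (fderiv ℝ (Literature.Analysis.FluidPDE.curl (u t)) x) ∧ Sr t = ∫ x, ⟪Literature.Analysis.FluidPDE.curl (u t) x, fderiv ℝ (u t) x (Literature.Analysis.FluidPDE.curl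 (u t) x)⟫_ℝ ∧ HasDerivAt Zr (2 * Sr t - 2 * ν * Pr t) t ∧ |Sr t| ≤ c * Zr t ^ (3/4 : ℝ) * Pr t ^ (3/4 : ℝ)) → ∃ α A t₀ : ℝ, α < 3 ∧ t₀ ∈ Set.Ioo 0 T ∧ ∀ t ∈ Set.Ico t₀ T, 2 * Sr t - 2 * ν * Pr t ≤ A * Zr t ^ α) :
    ∀ (c ν T : ℝ), 0 < c → 0 < ν → 0 < T → ∀ (u : ℝ → EuclideanSpace ℝ (Fin 3) → EuclideanSpace ℝ (Fin 3)) (p : ℝ → EuclideanSpace ℝ (Fin 3) → ℝ), Literature.Analysis.FluidPDE.IsMaximalSmoothSolution ν 0 u p T → Literature.Analysis.FluidPDE.IsLerayHopfOn T ν 0 (u 0) u → Literature.Analysis.FluidPDE.HasRapidSpatialDecay (u 0) → ∀ (Zr Pr Sr : ℝ → ℝ), (∀ t ∈ Set.Ioo 0 T, ∫⁻ x, ‖Literature.Analysis.FluidPDE.curl (u t) x‖ₑ ^ 2 = ENNReal.ofReal (Zr t) ∧ 0 ≤ Zr t ∧ 0 ≤ Pr t ∧ Pr t = ∫ x, Literature.Analysis.FluidPDE.frobeniusNormSq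 (fderiv ℝ (Literature.Analysis.FluidPDE.curl (u t)) x) ∧ Sr t = ∫ x, ⟪Literature.Analysis.FluidPDE.curl (u t) x, fderiv ℝ (u t) x (Literature.Analysis.FluidPDE.curl (u t) x)⟫_ℝ ∧ HasDerivAt Zr (2 * Sr t - 2 * ν * Pr t) t ∧ |Sr t| ≤ c * Zr t ^ (3/4 : ℝ) * Pr t ^ (3/4 : ℝ)) → ∀ ε : ℝ, 0 < ε → ∃ t₁ ∈ Set.Ioo 0 T, ∀ t ∈ Set.Ico t₁ T, 0 < Zr t ∧ 2 * Sr t - 2 * ν * Pr t ≤ ε * Zr t ^ 3 := by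
  intro c ν T hc hν hT u p hmax hLH hdec Zr Pr Sr hB ε hε
  obtain ⟨α, A, t₀, hα, ht₀, hlaw⟩ := hsub c ν T hc hν hT u p hmax hLH hdec Zr Pr Sr hB
  exact depletion_of_subcubicLaw hν hT hmax hLH hdec (D := fun t => 2 * Sr t - 2 * ν * Pr t)
    (fun t ht => ⟨(hB t ht).1, (hB t ht).2.1⟩) hα ht₀ hlaw hε

/-- **The crux from a sub-cubic law along every blow-up** (composition with the landed reduction
`productionEfficiencyDecay_of_depletion`, p585755): a Gibbon-type regime `Ż ≤ A·Z^ξ`, `ξ < 3`, sustained up to the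
blow-up time along every maximal smooth Leray–Hopf rapidly-decaying-datum solution implies
`EfficiencyFloor.ProductionEfficiencyDecay` by name. The crux itself is the borderline `ξ = 3` with vanishing
constant; the hypothesis is NOT proved here and stmt-22866 stays open. [folklore] -/
theorem productionEfficiencyDecay_of_subcubicLaw
    (hsub : ∀ (c ν T : ℝ), 0 < c → 0 < ν → 0 < T → ∀ (u : ℝ → EuclideanSpace ℝ (Fin 3) → EuclideanSpace ℝ (Fin 3)) (p : ℝ → EuclideanSpace ℝ (Fin 3) → ℝ), Literature.Analysis.FluidPDE.IsMaximalSmoothSolution ν 0 u p T → Literature.Analysis.FluidPDE.IsLerayHopfOn T ν 0 (u 0) u → Literature.Analysis.FluidPDE.HasRapidSpatialDecay (u 0) → ∀ (Zr Pr Sr : ℝ → ℝ), (∀ t ∈ Set.Ioo 0 T, ∫⁻ x, ‖Literature.Analysis.FluidPDE.curl (u t) x‖ₑ ^ 2 = ENNReal.ofReal (Zr t) ∧ 0 ≤ Zr t ∧ 0 ≤ Pr t ∧ Pr t = ∫ x, Literature.Analysis.FluidPDE.frobeniusNormSq (fderiv ℝ (Literature.Analysis.FluidPDE.curl (u t)) x)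 ∧ Sr t = ∫ x, ⟪Literature.Analysis.FluidPDE.curl (u t) x, fderiv ℝ (u t) x (Literature.Analysis.FluidPDE.curl (u t) x)⟫_ℝ ∧ HasDerivAt Zr (2 * Sr t - 2 * ν * Pr t) t ∧ |Sr t| ≤ c * Zr t ^ (3/4 : ℝ) * Pr t ^ (3/4 : ℝ)) → ∃ α A t₀ : ℝ, α < 3 ∧ t₀ ∈ Set.Ioo 0 T ∧ ∀ t ∈ Set.Ico t₀ T, 2 * Sr t - 2 * ν * Pr t ≤ A * Zr t ^ α) :
    Summit.NavierStokesRegularity.NavierStokesRegularity.Theses.EfficiencyFloor.ProductionEfficiencyDecay :=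
  productionEfficiencyDecay_of_depletion (stub_depletionGivenBudget_of_subcubicLaw hsub)

end ProductionEfficiencyDecay

end Summit.NavierStokesRegularity.NavierStokesRegularity.Theorems

end
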